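import Mathlib
import HarnessLib
import Summits.CriticalPhenomena.Ising3DConformalLimit.Theorems.HyperoctahedralRPTwoPointKernelOfLimitClauses
import Summits.CriticalPhenomena.Ising3DConformalLimit.Theorems.HyperoctahedralRPTwoPointLimitIsotropicHolds
import Summits.CriticalPhenomena.Ising3DConformalLimit.Theorems.HarmonicMomentsIsotropyTwoPointAsymptoticIsotropyLatticeIntegral
import Summits.CriticalPhenomena.Ising3DConformalLimit.Theorems.HarmonicMomentsIsotropyTwoPointAsymptoticIsotropyBulk
import Summits.CriticalPhenomena.Ising3DConformalLimit.Theorems.HarmonicMomentsIsotropyTwoPointAsymptoticIsotropyShells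
import Literature.Probability.LatticeModels.HighDimPointwiseTriviality
import Literature.Probability.LatticeModels.CriticalScalingDimension

/-!
# Vague asymptotic isotropy of the critical `ℤ³` two-point function from a scale-covariant limit, V:
# test functions — positivity, monotonicity and rotation of the bulk integrals; bulk/origin split
(route HarmonicMomentsIsotropy, support item stmt-CriticalPhenomena-6036 `TwoPointAsymptoticIsotropy`;
helper file 5/6 of the conditional line `ExistsScaleCovariantLimit → TwoPointAsymptoticIsotropy`;
independent of file IV `…Decay`)

For a continuous test function `φ ≥ 0` on `ℝ³` vanishing outside the ball of radius `M` and positive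
somewhere, and the kernel `K = S₂(0,·)` (continuous and positive off the origin):

* `exists_pos_bulk_integral`: some bulk integral `∫_{ε₁<‖y‖≤M} φ K` is positive (a point `y₁ ≠ 0`
  with `φ(y₁) > 0` exists because `{0}ᶜ` is dense);
* `bulk_integral_mono`: the bulk integrals increase as the inner radius decreases;
* `bulk_integral_comp_isometry`: for a linear isometry `T` with `K ∘ T = K` — for the Ising limit this
  is the tree's `kernel_rotation_invariant` (nine-mirror RP rigidity, route HyperoctahedralRP) —
  `∫ shell·(φ∘T)·K = ∫ shell·φ·K` (Lebesgue measure and the shells are `T`-invariant);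
* the lattice sums `Σ_x φ(x/L) ⟨σ₀σ_x⟩_{β_c}` split into a BULK part (sites with `‖x‖ > εL`) and an
  ORIGIN part (`‖x‖ ≤ εL`), the latter between `0` and `‖φ‖_∞ · mass(εL)`
  (`tsum_sample_eq_bulk_add_origin`, `origin_nonneg`, `origin_le_mass`).

References: H. Duminil-Copin, ICM 2022, §8.1. No definitions are introduced.
-/

noncomputable section

namespace Summit.CriticalPhenomena.Ising3DConformalLimit.HarmonicMomentsIsotropyTwoPoint

open Literature.Probability.LatticeModels MeasureTheory Filter Set Metric
open scoped Topology
open Summit.CriticalPhenomena.Ising3DConformalLimit.HyperoctahedralRPTwoPoint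

local notation "E3" => EuclideanSpace ℝ (Fin 3)

/-- The indicator of the spherical shell `{a < ‖y‖ ≤ b}`. -/
local notation3 (prettyPrint := false) "shell[" a "," b "]" =>
  Set.indicator {y : EuclideanSpace ℝ (Fin 3) | a < ‖y‖ ∧ ‖y‖ ≤ b} (fun _ => (1:ℝ))

/-- The indicator of the closed ball `{‖y‖ ≤ r}`. -/
local notation3 (prettyPrint := false) "ballInd[" r "]" =>
  Set.indicator {y : EuclideanSpace ℝ (Fin 3) | ‖y‖ ≤ r} (fun _ => (1:ℝ))

variable {ρ : ℝ → ℝ} {Δ : ℝ} {S : CorrFamily 3}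

/-! ### Bulk integrals of a test function: positivity, monotonicity, rotation invariance -/

/-- **Positivity of the bulk integral.** If `φ ≥ 0` is continuous, positive somewhere and vanishes
outside the ball of radius `M`, and `K = S₂(0,·)` is continuous and positive off the origin, then for
some `ε₁ > 0` the bulk integral `∫_{ε₁<‖y‖≤M} φ K` is positive. [folklore] -/
theorem exists_pos_bulk_integral (hcont : ContinuousOn (fun y : E3 => S 2 ![0, y]) {0}ᶜ)
    (hpos : ∀ y : E3, y ≠ 0 → 0 < S 2 ![0, y]) {φ : E3 → ℝ} (hφc : Continuous φ) {M : ℝ}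
    (hφM : ∀ y, M < ‖y‖ → φ y = 0) (hφ0 : ∀ y, 0 ≤ φ y) (hφpos : ∃ y, 0 < φ y) :
    ∃ ε₁ : ℝ, 0 < ε₁ ∧ 0 < ∫ y, shell[ε₁, M] y * (φ y * S 2 ![0, y]) := by
  -- a point `y₁ ≠ 0` with `φ y₁ > 0`
  obtain ⟨y₁, hy₁0, hy₁⟩ : ∃ y₁ : E3, y₁ ≠ 0 ∧ 0 < φ y₁ := by
    obtain ⟨y₀, hy₀⟩ := hφpos
    have hopen : IsOpen {y : E3 | 0 < φ y} := isOpen_lt continuous_const hφc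
    obtain ⟨y₁, hy₁mem, hy₁U⟩ :=
      (dense_compl_singleton (0 : E3)).exists_mem_open hopen ⟨y₀, hy₀⟩
    exact ⟨y₁, hy₁mem, hy₁U⟩
  have hK1 : 0 < S 2 ![0, y₁] := hpos y₁ hy₁0
  have hn1 : 0 < ‖y₁‖ := norm_pos_iff.2 hy₁0
  -- a small ball around `y₁` where `φ > φ y₁ / 2` and `K > K y₁ / 2`
  have hcaK : ContinuousAt (fun y : E3 => S 2 ![0, y]) y₁ :=
    hcont.continuousAt (isOpen_compl_singleton.mem_nhds hy₁0)
  obtain ⟨r, hr0, hr⟩ : ∃ r > 0, ∀ y ∈ ball y₁ r,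
      φ y₁ / 2 < φ y ∧ S 2 ![0, y₁] / 2 < S 2 ![0, y] := by
    have hev := (hφc.continuousAt.eventually (lt_mem_nhds (half_lt_self hy₁))).and
      (hcaK.eventually (lt_mem_nhds (half_lt_self hK1)))
    obtain ⟨r, hr0, hr⟩ := Metric.eventually_nhds_iff_ball.1 hev
    exact ⟨r, hr0, hr⟩
  set r₁ : ℝ := min r (‖y₁‖ / 2) with hr₁
  have hr₁0 : 0 < r₁ := lt_min hr0 (half_pos hn1)
  have hr₁r : r₁ ≤ r := min_le_left _ _
  have hr₁n : r₁ ≤ ‖y₁‖ / 2 := min_le_right _ _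
  refine ⟨‖y₁‖ / 4, by positivity, ?_⟩
  set ε₁ : ℝ := ‖y₁‖ / 4 with hε₁
  -- comparison function
  set g : E3 → ℝ := (ball y₁ r₁).indicator fun _ => φ y₁ / 2 * (S 2 ![0, y₁] / 2) with hg
  have hint : Integrable (fun y : E3 => shell[ε₁, M] y * (φ y * S 2 ![0, y])) volume := by
    refine integrable_shell_mul (hφc.continuousOn.mul (hcont.mono fun y hy h0 => ?_))
    have h0' : y = 0 := h0
    have hy1 : ε₁ ≤ ‖y‖ := hy.1
    rw [h0', norm_zero] at hy1
    have : 0 < ε₁ := by positivity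
    linarith
  have hle : g ≤ fun y : E3 => shell[ε₁, M] y * (φ y * S 2 ![0, y]) := by
    intro y
    show g y ≤ shell[ε₁, M] y * (φ y * S 2 ![0, y])
    by_cases hy : y ∈ ball y₁ r₁
    · have hdist : ‖y - y₁‖ < r₁ := by rwa [mem_ball, dist_eq_norm] at hy
      have hyr := hr y (ball_subset_ball hr₁r hy)
      have hn_low : ε₁ < ‖y‖ := by
        have := norm_sub_norm_le y₁ y
        rw [norm_sub_rev] at this
        rw [hε₁]
        linarith
      have hφy : 0 < φ y := by linarith [hyr.1]
      have hnM : ‖y‖ ≤ M := not_lt.1 fun h => hφy.ne' (hφM y h)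
      rw [hg, indicator_of_mem hy,
        indicator_of_mem (show y ∈ {y : E3 | ε₁ < ‖y‖ ∧ ‖y‖ ≤ M} from ⟨hn_low, hnM⟩), one_mul]
      exact mul_le_mul hyr.1.le hyr.2.le (by positivity) hφy.le
    · rw [hg, indicator_of_notMem hy]
      by_cases h0 : y = 0
      · rw [h0, shell_eq_zero_of_lt (show ‖(0:E3)‖ < ε₁ by rw [norm_zero]; positivity), zero_mul]
      · exact mul_nonneg (shell_nonneg _ _ _) (mul_nonneg (hφ0 y) (hpos y h0).le)
  have hg0 : 0 ≤ g := fun y => by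
    rw [hg]
    exact Set.indicator_nonneg (fun _ _ => by positivity) _
  have hg_int : ∫ y, g y = (volume : Measure E3).real (ball y₁ r₁) *
      (φ y₁ / 2 * (S 2 ![0, y₁] / 2)) := by
    rw [hg, integral_indicator_const _ measurableSet_ball, smul_eq_mul]
  have hball : 0 < (volume : Measure E3).real (ball y₁ r₁) :=
    ENNReal.toReal_pos (measure_ball_pos volume y₁ hr₁0).ne' measure_ball_lt_top.ne
  calc (0:ℝ) < ∫ y, g y := by rw [hg_int]; positivity
    _ ≤ ∫ y, shell[ε₁, M] y * (φ y * S 2 ![0, y]) :=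
        integral_mono_of_nonneg (Eventually.of_forall hg0) hint (Eventually.of_forall hle)

/-- **Monotonicity of the bulk integral in the inner radius**: for `0 < ε ≤ ε₁`,
`∫_{ε₁<‖y‖≤M} φ K ≤ ∫_{ε<‖y‖≤M} φ K` (`φ ≥ 0`, `K > 0` off `0`). [folklore] -/
theorem bulk_integral_mono (hcont : ContinuousOn (fun y : E3 => S 2 ![0, y]) {0}ᶜ)
    (hpos : ∀ y : E3, y ≠ 0 → 0 < S 2 ![0, y]) {φ : E3 → ℝ} (hφc : Continuous φ) {M : ℝ}
    (hφ0 : ∀ y, 0 ≤ φ y) {ε ε₁ : ℝ} (hε : 0 < ε) (hεε₁ : ε ≤ ε₁) :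
    ∫ y, shell[ε₁, M] y * (φ y * S 2 ![0, y]) ≤ ∫ y, shell[ε, M] y * (φ y * S 2 ![0, y]) := by
  have hint : Integrable (fun y : E3 => shell[ε, M] y * (φ y * S 2 ![0, y])) volume := by
    refine integrable_shell_mul (hφc.continuousOn.mul (hcont.mono fun y hy h0 => ?_))
    have h0' : y = 0 := h0
    have hy1 : ε ≤ ‖y‖ := hy.1
    rw [h0', norm_zero] at hy1
    linarith
  refine integral_mono_of_nonneg (Eventually.of_forall fun y => ?_) hint
    (Eventually.of_forall fun y => ?_)
  · by_cases h0 : y = 0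
    · show (0:ℝ) ≤ shell[ε₁, M] y * (φ y * S 2 ![0, y])
      rw [h0, shell_eq_zero_of_lt (show ‖(0:E3)‖ < ε₁ by rw [norm_zero]; linarith), zero_mul]
    · exact mul_nonneg (shell_nonneg _ _ _) (mul_nonneg (hφ0 y) (hpos y h0).le)
  · show shell[ε₁, M] y * (φ y * S 2 ![0, y]) ≤ shell[ε, M] y * (φ y * S 2 ![0, y])
    by_cases h0 : y = 0
    · rw [h0, shell_eq_zero_of_lt (show ‖(0:E3)‖ < ε₁ by rw [norm_zero]; linarith),
        shell_eq_zero_of_lt (show ‖(0:E3)‖ < ε by rw [norm_zero]; linarith)]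
    · refine mul_le_mul_of_nonneg_right ?_ (mul_nonneg (hφ0 y) (hpos y h0).le)
      exact Set.indicator_le_indicator_of_subset
        (show {y : E3 | ε₁ < ‖y‖ ∧ ‖y‖ ≤ M} ⊆ {y : E3 | ε < ‖y‖ ∧ ‖y‖ ≤ M} from
          fun z hz => ⟨lt_of_le_of_lt hεε₁ hz.1, hz.2⟩)
        (fun _ => zero_le_one) y

/-- **Rotation invariance of the bulk integrals**: for a linear isometry `T` of `ℝ³` and a kernel
`K = S₂(0,·)` invariant under `T`, `∫ shell[ε,M] (φ ∘ T) K = ∫ shell[ε,M] φ K` (Lebesgue measure and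
the shells are `T`-invariant). [folklore] -/
theorem bulk_integral_comp_isometry (T : E3 ≃ₗᵢ[ℝ] E3)
    (hKT : ∀ y : E3, S 2 ![0, T y] = S 2 ![0, y]) (φ : E3 → ℝ) (ε M : ℝ) :
    ∫ y, shell[ε, M] y * (φ (T y) * S 2 ![0, y]) = ∫ y, shell[ε, M] y * (φ y * S 2 ![0, y]) := by
  set f : E3 → ℝ := fun z => shell[ε, M] z * (φ z * S 2 ![0, z]) with hf
  have h1 : (fun y => shell[ε, M] y * (φ (T y) * S 2 ![0, y])) = fun y => f (T y) := by
    funext y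
    simp only [hf, hKT y, Set.indicator_apply, mem_setOf_eq, LinearIsometryEquiv.norm_map]
  rw [h1]
  exact (T.measurePreserving).integral_comp T.toMeasurableEquiv.measurableEmbedding f

/-- Summability of a lattice function vanishing outside a Euclidean ball (a finite sum; cf. the
identical public lemma of file IV, kept private here so that files IV and V are independent).
[folklore] -/
private theorem summable_of_norm_bound_aux {f : Site 3 → ℝ} {M : ℝ}
    (h : ∀ x, M < ‖siteVec x‖ → f x = 0) : Summable f := by
  refine summable_of_box (N := ⌈M / 1⌉₊) fun x hx => h x ?_
  by_contra hle
  have hle' : ‖(1:ℝ) • siteVec x‖ ≤ M := by rw [one_smul]; exact not_lt.1 hle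
  exact absurd (supNorm_le_ceil_of_norm_smul_le one_pos hle') (not_le.2 hx)

/-! ### Bulk / origin decomposition of the lattice sums -/

/-- Pointwise: `φ = shell[ε,M]·φ + ballInd[ε]·φ` for `φ` vanishing outside the ball of radius `M`.
[folklore] -/
theorem eq_shell_mul_add_ballInd_mul {φ : E3 → ℝ} {M : ℝ} (hφM : ∀ y, M < ‖y‖ → φ y = 0) (ε : ℝ)
    (y : E3) : φ y = shell[ε, M] y * φ y + ballInd[ε] y * φ y := by
  by_cases h1 : ‖y‖ ≤ ε
  · rw [indicator_of_mem (show y ∈ {y : E3 | ‖y‖ ≤ ε} from h1),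
      indicator_of_notMem (show y ∉ {y : E3 | ε < ‖y‖ ∧ ‖y‖ ≤ M} from fun h => absurd h.1 (not_lt.2 h1))]
    ring
  · rw [indicator_of_notMem (show y ∉ {y : E3 | ‖y‖ ≤ ε} from h1)]
    by_cases h2 : ‖y‖ ≤ M
    · rw [indicator_of_mem (show y ∈ {y : E3 | ε < ‖y‖ ∧ ‖y‖ ≤ M} from ⟨not_le.1 h1, h2⟩)]
      ring
    · rw [indicator_of_notMem (show y ∉ {y : E3 | ε < ‖y‖ ∧ ‖y‖ ≤ M} from fun h => h2 h.2),
        hφM y (not_le.1 h2)]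
      ring

/-- A test function vanishing outside radius `M`, sampled at `L⁻¹x` (`L > 0`), vanishes at the sites
with `‖x‖ > M L`; hence all the sampled sums below are finite. [folklore] -/
theorem sample_eq_zero_of_lt {φ : E3 → ℝ} {M L : ℝ} (hL : 0 < L) (hφM : ∀ y, M < ‖y‖ → φ y = 0)
    (x : Site 3) (hx : M * L < ‖siteVec x‖) : φ (L⁻¹ • siteVec x) = 0 := by
  refine hφM _ ?_
  rw [norm_smul, Real.norm_eq_abs, abs_of_pos (inv_pos.2 hL), ← div_eq_inv_mul, lt_div_iff₀ hL]
  exact hx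

/-- **Bulk/origin decomposition of the sampled sum**:
`Σ φ(L⁻¹x)G(x) = Σ shell[ε,M](L⁻¹x)φ(L⁻¹x)G(x) + Σ ballInd[ε](L⁻¹x)φ(L⁻¹x)G(x)` (`L > 0`).
[folklore] -/
theorem tsum_sample_eq_bulk_add_origin {φ : E3 → ℝ} {M L : ℝ} (hL : 0 < L)
    (hφM : ∀ y, M < ‖y‖ → φ y = 0) (ε : ℝ) :
    ∑' x : Site 3, φ (L⁻¹ • siteVec x) * criticalTwoPoint 3 x =
      ∑' x : Site 3, shell[ε, M] (L⁻¹ • siteVec x) * φ (L⁻¹ • siteVec x) * criticalTwoPoint 3 x +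
        ∑' x : Site 3, ballInd[ε] (L⁻¹ • siteVec x) * φ (L⁻¹ • siteVec x) *
          criticalTwoPoint 3 x := by
  have hs1 : Summable fun x : Site 3 =>
      shell[ε, M] (L⁻¹ • siteVec x) * φ (L⁻¹ • siteVec x) * criticalTwoPoint 3 x :=
    summable_of_norm_bound_aux (M := M * L) fun x hx => by
      rw [sample_eq_zero_of_lt hL hφM x hx, mul_zero, zero_mul]
  have hs2 : Summable fun x : Site 3 =>
      ballInd[ε] (L⁻¹ • siteVec x) * φ (L⁻¹ • siteVec x) * criticalTwoPoint 3 x :=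
    summable_of_norm_bound_aux (M := M * L) fun x hx => by
      rw [sample_eq_zero_of_lt hL hφM x hx, mul_zero, zero_mul]
  rw [← hs1.tsum_add hs2]
  refine tsum_congr fun x => ?_
  rw [← add_mul, ← eq_shell_mul_add_ballInd_mul hφM]

/-- The origin part is nonnegative (`φ ≥ 0`). [folklore] -/
theorem origin_nonneg {φ : E3 → ℝ} (hφ0 : ∀ y, 0 ≤ φ y) (ε L : ℝ) :
    0 ≤ ∑' x : Site 3, ballInd[ε] (L⁻¹ • siteVec x) * φ (L⁻¹ • siteVec x) *
      criticalTwoPoint 3 x :=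
  tsum_nonneg fun x => mul_nonneg (mul_nonneg (Set.indicator_nonneg (fun _ _ => zero_le_one) _) (hφ0 _))
    (criticalTwoPoint_nonneg' x)

/-- **The origin part is dominated by the lattice mass**: for `|φ| ≤ B`, `L > 0`, `ε > 0`,
`Σ ballInd[ε](L⁻¹x) φ(L⁻¹x) G(x) ≤ B · Σ_{‖x‖ ≤ εL} G(x)`. [folklore] -/
theorem origin_le_mass {φ : E3 → ℝ} {B M L ε : ℝ} (hL : 0 < L) (hB : ∀ y, |φ y| ≤ B)
    (hφM : ∀ y, M < ‖y‖ → φ y = 0) :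
    ∑' x : Site 3, ballInd[ε] (L⁻¹ • siteVec x) * φ (L⁻¹ • siteVec x) * criticalTwoPoint 3 x ≤
      B * ∑' x : Site 3, ballInd[ε * L] (siteVec x) * criticalTwoPoint 3 x := by
  have hB0 : 0 ≤ B := (abs_nonneg _).trans (hB 0)
  have hind : ∀ x : Site 3, ballInd[ε] (L⁻¹ • siteVec x) = ballInd[ε * L] (siteVec x) := by
    intro x
    have hn : ‖L⁻¹ • siteVec x‖ = L⁻¹ * ‖siteVec x‖ := by
      rw [norm_smul, Real.norm_eq_abs, abs_of_pos (inv_pos.2 hL)]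
    have hiff : L⁻¹ * ‖siteVec x‖ ≤ ε ↔ ‖siteVec x‖ ≤ ε * L := by
      rw [← div_eq_inv_mul, div_le_iff₀ hL]
    simp only [Set.indicator_apply, mem_setOf_eq, hn, hiff]
  have hs1 : Summable fun x : Site 3 =>
      ballInd[ε] (L⁻¹ • siteVec x) * φ (L⁻¹ • siteVec x) * criticalTwoPoint 3 x :=
    summable_of_norm_bound_aux (M := M * L) fun x hx => by
      rw [sample_eq_zero_of_lt hL hφM x hx, mul_zero, zero_mul]
  have hs2 : Summable fun x : Site 3 => B * (ballInd[ε * L] (siteVec x) * criticalTwoPoint 3 x) :=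
    (summable_of_norm_bound_aux (M := ε * L) fun x hx => by
      rw [indicator_of_notMem (show siteVec x ∉ {y : E3 | ‖y‖ ≤ ε * L} from
        fun h => absurd h (not_le.2 hx)), zero_mul]).mul_left B
  rw [← tsum_mul_left]
  refine hs1.tsum_le_tsum (fun x => ?_) hs2
  rw [hind x]
  have h1 : φ (L⁻¹ • siteVec x) ≤ B := (le_abs_self _).trans (hB _)
  have h2 : 0 ≤ ballInd[ε * L] (siteVec x) * criticalTwoPoint 3 x :=
    mul_nonneg (Set.indicator_nonneg (fun _ _ => zero_le_one) _) (criticalTwoPoint_nonneg' x)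
  calc ballInd[ε * L] (siteVec x) * φ (L⁻¹ • siteVec x) * criticalTwoPoint 3 x
      = φ (L⁻¹ • siteVec x) * (ballInd[ε * L] (siteVec x) * criticalTwoPoint 3 x) := by ring
    _ ≤ B * (ballInd[ε * L] (siteVec x) * criticalTwoPoint 3 x) :=
        mul_le_mul_of_nonneg_right h1 h2

end Summit.CriticalPhenomena.Ising3DConformalLimit.HarmonicMomentsIsotropyTwoPoint

end
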